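import Literature.NumberTheory.LFunctions.Zhang2022.ObjectiveTwinKernelGram

/-!
# `F_ℓ` on two-frequency profiles `s·e^{−iπay} + r·e^{−iπby}` (real coefficients): additivity
# (cell `landau-siegel`, §A / §B-ell; the prover item «mainTermFormEll_afeDir_add» released by ls-obj-eng-2)

Topic `Literature/NumberTheory/LFunctions/Zhang2022` (Landau–Siegel audit tree; verdict-neutral).
Y. Zhang, arXiv:2211.02515v1 (2022) [Zhang2022LandauSiegel] is an unrefereed manuscript under adjudication;
NOTHING here asserts or denies its Theorems 1–2 and nothing here is a claim about Landau–Siegel zeros.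

`MainTermFormEll` evaluates the deformed main-term form `F_ℓ = mainTermFormEll ℓ` on ONE pure frequency
`k_j(y) = e^{−iπjy}`: `F_ℓ(k_j) = 8π(j−ℓ)(j−2ℓ)(j−3ℓ)/j` (`mainTermFormEll_afeDir`).  The B-ell cell's `K₀`
designs (coefficient patterns `k₁ − k₃`, `k₁ + k₂`, `k₂ + k₃` of two frequencies; ls-B-ref-2's K0-EXACT.md) and
the §A twin need `F_ℓ` on TWO-frequency profiles.  This file PROVES (elementary calculus, kernel-checked):

* `mainTermFormEll_twoComb` — for `a ≠ b`, `a, b ≥ 1` and REAL `s, r`: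
  `F_ℓ(s·k_a + r·k_b) = s²·F_ℓ(k_a) + r²·F_ℓ(k_b)` written out as
  `s²·8π(a−ℓ)(a−2ℓ)(a−3ℓ)/a + r²·8π(b−ℓ)(b−2ℓ)(b−3ℓ)/b`, and the additivity form
  `mainTermFormEll_twoComb_eq_add`;
* the three `K₀` cubics: `F_ℓ(k₁+k₂) = π(40 − 144ℓ + 176ℓ² − 72ℓ³)`, `F_ℓ(k₂+k₃) = π(104 − 240ℓ + 176ℓ² − 40ℓ³)`,
  `F_ℓ(k₁−k₃) = π(80 − 192ℓ + 176ℓ² − 64ℓ³)` (`mainTermFormEll_k12 / _k23 / _k13`).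

WHY the cross terms vanish (ls-obj-eng-2's sketch F1–F4, here the proof): with `b < a`, `n = a − b`,
`k_a k̄_b = k_n` (`Objective.afeDir_mul_conj_afeDir_of_le`), and every `∫₀¹ k_m = ((−1)^m − 1)/c_m` (`c_m = −iπm`) is
PURELY IMAGINARY (`integral_afeDir_eq_mul_I`); the five constituents of `F_ℓ` then split as
`‖(s k_a + r k_b)′‖² = s²a²π² + r²b²π² + 2srabπ²·Re k_n` (cross integrates to `Re ∫k_n = 0`),
`Im⟨g′,g⟩`: cross `sr(c_a ∫k_n + c_b conj ∫k_n)` is real, `‖g‖²`: cross `2sr Re ∫k_n = 0`, the boundary terms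
vanish because `g(0) = s + r`, `g(1) = s(−1)^a + r(−1)^b` and `i·∫g` are real, and `Im⟨g, Sg⟩`: cross
`sr[(∫k_n − ∫k_a)/c̄_b + (conj ∫k_n − ∫k_b)/c̄_a]` is real.  Real coefficients are essential (a relative phase
`s r̄ ∉ ℝ` picks up the imaginary cross terms); the complex-coefficient form on the modes `1, 2, 3` is
ls-obj-eng-3's `ObjectiveTwinEllKernelForm` (complementary, not restated here).

STATUS OF THE OBJECT (as in `MainTermFormEll`): for `ℓ ≠ 1`, `F_ℓ` is the CONTINUED main-term calculus, not a
mean value the manuscript computes; these are identities about that quadratic form and nothing else.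

## References
* Y. Zhang, arXiv:2211.02515v1 (2022), §2 (2.10), (2.13), (2.23)–(2.25). [cite: Zhang2022LandauSiegel, §2]
-/

noncomputable section

open MeasureTheory Set intervalIntegral
open scoped Real ComplexConjugate
open Complex (I)

namespace Literature.NumberTheory.LFunctions.Zhang2022

/-! ## The modes and their integrals -/

/-- `k_j(1) = (−1)^j` as a REAL number cast. [cite: Zhang2022LandauSiegel, §2 (2.13)] -/
theorem afeDir_one_ofReal (j : ℕ) : afeDir j 1 = (((-1 : ℝ) ^ j : ℝ) : ℂ) := by
  rw [afeDir_one]; push_cast; rfl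

/-- `c_j = −iπj = (−jπ)·i` with a real first factor. [cite: Zhang2022LandauSiegel, §2 (2.13)] -/
theorem afeFreq_eq_ofReal_mul_I (j : ℕ) : afeFreq j = ((-((j : ℝ) * π) : ℝ) : ℂ) * I := by
  unfold afeFreq; push_cast; ring

/-- **`∫₀¹ k_m` is purely imaginary**: `∫₀¹ e^{−iπmy} dy = ((−1)^m − 1)/(−iπm) = (((−1)^m − 1)/(mπ))·i` for
`m ≥ 1`. [cite: Zhang2022LandauSiegel, §2 (2.13)] -/
theorem integral_afeDir_eq_mul_I {m : ℕ} (hm : m ≠ 0) :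
    ∫ y in (0:ℝ)..1, afeDir m y = (((((-1 : ℝ) ^ m - 1) / ((m : ℝ) * π)) : ℝ) : ℂ) * I := by
  rw [primitive_afeDir hm, afeDir_one, div_eq_mul_inv, inv_afeFreq hm]
  push_cast
  ring

/-- `∫₀¹ conj k_m = conj ∫₀¹ k_m`. [cite: Zhang2022LandauSiegel, §2 (2.13)] -/
theorem integral_conj_afeDir (m : ℕ) :
    ∫ y in (0:ℝ)..1, conj (afeDir m y) = conj (∫ y in (0:ℝ)..1, afeDir m y) :=
  intervalIntegral_conj

/-- `∫₀¹ Re k_m = 0` for `m ≥ 1`. [cite: Zhang2022LandauSiegel, §2 (2.13)] -/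
theorem integral_re_afeDir {m : ℕ} (hm : m ≠ 0) : ∫ y in (0:ℝ)..1, (afeDir m y).re = 0 := by
  have h := Complex.reCLM.intervalIntegral_comp_comm (μ := volume)
    ((continuous_afeDir m).intervalIntegrable 0 1)
  simp only [Complex.reCLM_apply] at h
  rw [h, integral_afeDir_eq_mul_I hm, Complex.re_ofReal_mul, Complex.I_re, mul_zero]

/-- `|k_j(y)|² = 1` in coordinates. [cite: Zhang2022LandauSiegel, §2 (2.13)] -/
theorem afeDir_re_sq_add_im_sq (j : ℕ) (y : ℝ) :
    (afeDir j y).re * (afeDir j y).re + (afeDir j y).im * (afeDir j y).im = 1 := by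
  have h := Complex.sq_norm (afeDir j y)
  rw [norm_afeDir, one_pow, Complex.normSq_apply] at h
  exact h.symm

/-- Integral of a combination of the five modes `1, k_a, k_b, k_n, k̄_n`.
[cite: Zhang2022LandauSiegel, §2 (2.13)] -/
theorem integral_modes5 (a b n : ℕ) (A B C D E : ℂ) :
    ∫ y in (0:ℝ)..1, (A + B * afeDir a y + C * afeDir b y + D * afeDir n y + E * conj (afeDir n y)) =
      A + B * (∫ y in (0:ℝ)..1, afeDir a y) + C * (∫ y in (0:ℝ)..1, afeDir b y)
        + D * (∫ y in (0:ℝ)..1, afeDir n y) + E * conj (∫ y in (0:ℝ)..1, afeDir n y) := by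
  have hA : IntervalIntegrable (fun _ => A) volume (0:ℝ) 1 := intervalIntegrable_const
  have hB : IntervalIntegrable (fun y => B * afeDir a y) volume (0:ℝ) 1 :=
    ((continuous_afeDir a).intervalIntegrable (μ := volume) 0 1).const_mul B
  have hC : IntervalIntegrable (fun y => C * afeDir b y) volume (0:ℝ) 1 :=
    ((continuous_afeDir b).intervalIntegrable (μ := volume) 0 1).const_mul C
  have hD : IntervalIntegrable (fun y => D * afeDir n y) volume (0:ℝ) 1 :=
    ((continuous_afeDir n).intervalIntegrable (μ := volume) 0 1).const_mul D
  have hE : IntervalIntegrable (fun y => E * conj (afeDir n y)) volume (0:ℝ) 1 :=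
    ((Complex.continuous_conj.comp (continuous_afeDir n)).intervalIntegrable (μ := volume) 0 1).const_mul E
  rw [intervalIntegral.integral_add (((hA.add hB).add hC).add hD) hE,
    intervalIntegral.integral_add ((hA.add hB).add hC) hD,
    intervalIntegral.integral_add (hA.add hB) hC,
    intervalIntegral.integral_add hA hB,
    intervalIntegral.integral_const_mul, intervalIntegral.integral_const_mul,
    intervalIntegral.integral_const_mul, intervalIntegral.integral_const_mul,
    intervalIntegral.integral_const]
  simp only [sub_zero, one_smul, integral_conj_afeDir]

/-! ## Two-frequency profiles with real coefficients -/

/-- The two-frequency profile `g = s·k_a + r·k_b` (`s, r ∈ ℝ`). [cite: Zhang2022LandauSiegel, §2 (2.13), (2.23)–(2.25)] -/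
def twoComb (a b : ℕ) (s r : ℝ) : ℝ → ℂ := fun y => (s : ℂ) * afeDir a y + (r : ℂ) * afeDir b y

/-- Its derivative `g′ = s·c_a k_a + r·c_b k_b`. [cite: Zhang2022LandauSiegel, §2 (2.13), (2.23)–(2.25)] -/
def twoComb' (a b : ℕ) (s r : ℝ) : ℝ → ℂ := fun y => (s : ℂ) * afeDir' a y + (r : ℂ) * afeDir' b y

/-- `g = s·k_a + r·k_b ∈ C¹[0,1]` with derivative `g′`. [cite: Zhang2022LandauSiegel, §2 (2.13), (2.23)–(2.25)] -/
theorem isC1_twoComb (a b : ℕ) (s r : ℝ) : IsC1OnUnitInterval (twoComb a b s r) (twoComb' a b s r) := by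
  refine ⟨?_, ?_, fun y _ => ?_⟩
  · exact ((continuous_const.mul (continuous_afeDir a)).add
      (continuous_const.mul (continuous_afeDir b))).continuousOn
  · have ha : Continuous (afeDir' a) := continuous_const.mul (continuous_afeDir a)
    have hb : Continuous (afeDir' b) := continuous_const.mul (continuous_afeDir b)
    exact ((continuous_const.mul ha).add (continuous_const.mul hb)).continuousOn
  · exact ((hasDerivAt_afeDir a y).const_mul (s : ℂ)).add ((hasDerivAt_afeDir b y).const_mul (r : ℂ))

/-- **`F_ℓ` on `s·k_a + r·k_b`, `b < a`, real `s, r`** — the computational core: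
`F_ℓ(s k_a + r k_b) = s²·8π(a−ℓ)(a−2ℓ)(a−3ℓ)/a + r²·8π(b−ℓ)(b−2ℓ)(b−3ℓ)/b` (all cross terms vanish).
[cite: Zhang2022LandauSiegel, §2 (2.10), (2.13)] -/
theorem mainTermFormEll_twoComb_of_lt {a b : ℕ} (hb : b ≠ 0) (hba : b < a) (s r ℓ : ℝ) :
    mainTermFormEll ℓ (twoComb a b s r) (twoComb' a b s r) =
      s ^ 2 * (8 * π * (((a : ℝ) - ℓ) * ((a : ℝ) - 2 * ℓ) * ((a : ℝ) - 3 * ℓ)) / a)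
        + r ^ 2 * (8 * π * (((b : ℝ) - ℓ) * ((b : ℝ) - 2 * ℓ) * ((b : ℝ) - 3 * ℓ)) / b) := by
  have ha : a ≠ 0 := by omega
  have hn : a - b ≠ 0 := by omega
  set n := a - b with hn_def
  have har : (a : ℝ) ≠ 0 := Nat.cast_ne_zero.mpr ha
  have hbr : (b : ℝ) ≠ 0 := Nat.cast_ne_zero.mpr hb
  have hnr : (n : ℝ) ≠ 0 := Nat.cast_ne_zero.mpr hn
  have hπ : π ≠ 0 := Real.pi_ne_zero
  -- the mode integrals (purely imaginary)
  set ja : ℝ := ((-1 : ℝ) ^ a - 1) / ((a : ℝ) * π) with hja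
  set jb : ℝ := ((-1 : ℝ) ^ b - 1) / ((b : ℝ) * π) with hjb
  set jn : ℝ := ((-1 : ℝ) ^ n - 1) / ((n : ℝ) * π) with hjn
  have Ia : ∫ y in (0:ℝ)..1, afeDir a y = (ja : ℂ) * I := integral_afeDir_eq_mul_I ha
  have Ib : ∫ y in (0:ℝ)..1, afeDir b y = (jb : ℂ) * I := integral_afeDir_eq_mul_I hb
  have In : ∫ y in (0:ℝ)..1, afeDir n y = (jn : ℂ) * I := integral_afeDir_eq_mul_I hn
  -- pointwise algebra of the modes
  have hUU : ∀ y, afeDir a y * conj (afeDir a y) = 1 := afeDir_mul_conj a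
  have hVV : ∀ y, afeDir b y * conj (afeDir b y) = 1 := afeDir_mul_conj b
  have hUV : ∀ y, afeDir a y * conj (afeDir b y) = afeDir n y :=
    fun y => Objective.afeDir_mul_conj_afeDir_of_le hba.le y
  have hVU : ∀ y, afeDir b y * conj (afeDir a y) = conj (afeDir n y) :=
    fun y => Objective.afeDir_mul_conj_afeDir_of_ge hba.le y
  have hWre : ∀ y, (afeDir n y).re =
      (afeDir a y).re * (afeDir b y).re + (afeDir a y).im * (afeDir b y).im := by
    intro y; rw [← hUV y]; simp [Complex.mul_re]
  have hU := afeDir_re_sq_add_im_sq a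
  have hV := afeDir_re_sq_add_im_sq b
  -- (T1) `∫ ‖g′‖² = s²a²π² + r²b²π²`
  have p1 : ∀ y, ‖twoComb' a b s r y‖ ^ 2 =
      (s * a * π) ^ 2 + (r * b * π) ^ 2 + 2 * s * r * a * b * π ^ 2 * (afeDir n y).re := by
    intro y
    rw [hWre y, Complex.sq_norm, Complex.normSq_apply]
    simp only [twoComb', afeDir', Complex.add_re, Complex.add_im, Complex.mul_re, Complex.mul_im,
      Complex.ofReal_re, Complex.ofReal_im, afeFreq_re, afeFreq_im, zero_mul, sub_zero, zero_sub,
      add_zero, zero_add]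
    linear_combination (s * a * π) ^ 2 * hU y + (r * b * π) ^ 2 * hV y
  have hWc : Continuous fun y => (afeDir n y).re := Complex.continuous_re.comp (continuous_afeDir n)
  have T1 : ∫ y in (0:ℝ)..1, ‖twoComb' a b s r y‖ ^ 2 = (s * a * π) ^ 2 + (r * b * π) ^ 2 := by
    simp only [p1]
    have hi : IntervalIntegrable (fun y => 2 * s * r * a * b * π ^ 2 * (afeDir n y).re) volume (0:ℝ) 1 :=
      ((continuous_const.mul hWc).intervalIntegrable (μ := volume) 0 1)
    rw [intervalIntegral.integral_add intervalIntegrable_const hi,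
      intervalIntegral.integral_const, intervalIntegral.integral_const_mul, integral_re_afeDir hn]
    simp
  -- (T2) `∫ g′ ḡ = s²c_a + r²c_b + sr(c_a ∫k_n + c_b conj ∫k_n)`
  have p2 : ∀ y, twoComb' a b s r y * conj (twoComb a b s r y) =
      ((s : ℂ) ^ 2 * afeFreq a + (r : ℂ) ^ 2 * afeFreq b) + 0 * afeDir a y + 0 * afeDir b y
        + ((s : ℂ) * r * afeFreq a) * afeDir n y + ((s : ℂ) * r * afeFreq b) * conj (afeDir n y) := by
    intro y
    simp only [twoComb, twoComb', afeDir', map_add, map_mul, Complex.conj_ofReal]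
    linear_combination ((s : ℂ) ^ 2 * afeFreq a) * hUU y + ((s : ℂ) * r * afeFreq a) * hUV y
      + ((r : ℂ) * s * afeFreq b) * hVU y + ((r : ℂ) ^ 2 * afeFreq b) * hVV y
  have T2 : (∫ y in (0:ℝ)..1, twoComb' a b s r y * conj (twoComb a b s r y)).im =
      -(s ^ 2 * (a * π)) - r ^ 2 * (b * π) := by
    simp only [p2]
    rw [integral_modes5, Ia, Ib, In, afeFreq_eq_ofReal_mul_I, afeFreq_eq_ofReal_mul_I]
    simp only [← Complex.ofReal_pow, map_mul, Complex.conj_ofReal, Complex.conj_I, Complex.add_im,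
      Complex.mul_im, Complex.mul_re, Complex.ofReal_re, Complex.ofReal_im, Complex.I_re, Complex.I_im,
      Complex.neg_re, Complex.neg_im, Complex.zero_re, Complex.zero_im]
    ring
  -- boundary values: `g(0) = s + r`, `g(1) = s(−1)^a + r(−1)^b` are real
  have g0 : twoComb a b s r 0 = ((s + r : ℝ) : ℂ) := by
    simp only [twoComb, afeDir_zero, mul_one]; push_cast; ring
  have g1 : twoComb a b s r 1 = ((s * (-1 : ℝ) ^ a + r * (-1 : ℝ) ^ b : ℝ) : ℂ) := by
    simp only [twoComb, afeDir_one_ofReal]; push_cast; ring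
  have B1 : (twoComb a b s r 0 * conj (twoComb a b s r 1)).im = 0 := by
    rw [g0, g1, Complex.conj_ofReal, ← Complex.ofReal_mul, Complex.ofReal_im]
  -- (T3) `∫ ‖g‖² = s² + r²`
  have p3 : ∀ y, ‖twoComb a b s r y‖ ^ 2 = s ^ 2 + r ^ 2 + 2 * s * r * (afeDir n y).re := by
    intro y
    rw [hWre y, Complex.sq_norm, Complex.normSq_apply]
    simp only [twoComb, Complex.add_re, Complex.add_im, Complex.mul_re, Complex.mul_im,
      Complex.ofReal_re, Complex.ofReal_im, zero_mul, sub_zero, add_zero]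
    linear_combination s ^ 2 * hU y + r ^ 2 * hV y
  have T3 : ∫ y in (0:ℝ)..1, ‖twoComb a b s r y‖ ^ 2 = s ^ 2 + r ^ 2 := by
    simp only [p3]
    have hi : IntervalIntegrable (fun y => 2 * s * r * (afeDir n y).re) volume (0:ℝ) 1 :=
      ((continuous_const.mul hWc).intervalIntegrable (μ := volume) 0 1)
    rw [intervalIntegral.integral_add intervalIntegrable_const hi,
      intervalIntegral.integral_const, intervalIntegral.integral_const_mul, integral_re_afeDir hn]
    simp
  -- `∫₀¹ g = (s ja + r jb) i`
  have Ig : ∫ y in (0:ℝ)..1, twoComb a b s r y = ((s * ja + r * jb : ℝ) : ℂ) * I := by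
    have h := integral_modes5 a b n 0 s r 0 0
    simp only [zero_add, zero_mul, add_zero] at h
    change ∫ y in (0:ℝ)..1, ((s : ℂ) * afeDir a y + (r : ℂ) * afeDir b y) = _
    rw [h, Ia, Ib]; push_cast; ring
  have B2 : (conj (∫ y in (0:ℝ)..1, twoComb a b s r y) *
      (twoComb a b s r 0 + twoComb a b s r 1)).re = 0 := by
    rw [Ig, g0, g1]
    simp only [map_mul, Complex.conj_ofReal, Complex.conj_I, Complex.mul_re, Complex.add_re,
      Complex.add_im, Complex.ofReal_re, Complex.ofReal_im, Complex.I_re, Complex.I_im,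
      Complex.neg_re, Complex.neg_im, Complex.mul_im]
    ring
  -- (T4) `∫ g · conj(Sg)`
  have hS : ∀ x, ∫ t in (0:ℝ)..x, twoComb a b s r t =
      (s : ℂ) * ((afeDir a x - 1) / afeFreq a) + (r : ℂ) * ((afeDir b x - 1) / afeFreq b) := by
    intro x
    change ∫ t in (0:ℝ)..x, ((s : ℂ) * afeDir a t + (r : ℂ) * afeDir b t) = _
    rw [intervalIntegral.integral_add
        (((continuous_afeDir a).intervalIntegrable (μ := volume) 0 x).const_mul _)
        (((continuous_afeDir b).intervalIntegrable (μ := volume) 0 x).const_mul _),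
      intervalIntegral.integral_const_mul, intervalIntegral.integral_const_mul,
      primitive_afeDir ha, primitive_afeDir hb]
  have hca : conj (afeFreq a) ≠ 0 := by
    rw [conj_afeFreq]; exact neg_ne_zero.mpr (afeFreq_ne_zero ha)
  have hcb : conj (afeFreq b) ≠ 0 := by
    rw [conj_afeFreq]; exact neg_ne_zero.mpr (afeFreq_ne_zero hb)
  have p4 : ∀ x, twoComb a b s r x * conj (∫ t in (0:ℝ)..x, twoComb a b s r t) =
      ((s : ℂ) ^ 2 / conj (afeFreq a) + (r : ℂ) ^ 2 / conj (afeFreq b))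
        + (-(s : ℂ) ^ 2 / conj (afeFreq a) - (s : ℂ) * r / conj (afeFreq b)) * afeDir a x
        + (-(s : ℂ) * r / conj (afeFreq a) - (r : ℂ) ^ 2 / conj (afeFreq b)) * afeDir b x
        + ((s : ℂ) * r / conj (afeFreq b)) * afeDir n x
        + ((s : ℂ) * r / conj (afeFreq a)) * conj (afeDir n x) := by
    intro x
    rw [hS x]
    simp only [twoComb, map_add, map_mul, map_div₀, map_sub, map_one, Complex.conj_ofReal]
    field_simp
    linear_combination (conj (afeFreq b) * (s : ℂ) ^ 2) * hUU x
      + (conj (afeFreq a) * (s : ℂ) * r) * hUV x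
      + (conj (afeFreq b) * (r : ℂ) * s) * hVU x + (conj (afeFreq a) * (r : ℂ) ^ 2) * hVV x
  have T4 : (∫ x in (0:ℝ)..1, twoComb a b s r x * conj (∫ t in (0:ℝ)..x, twoComb a b s r t)).im =
      -(s ^ 2 / (a * π)) - r ^ 2 / (b * π) := by
    simp only [p4]
    rw [integral_modes5, Ia, Ib, In, conj_afeFreq, conj_afeFreq]
    simp only [div_eq_mul_inv, inv_neg, inv_afeFreq ha, inv_afeFreq hb]
    simp only [← Complex.ofReal_pow, map_mul, Complex.conj_ofReal, Complex.conj_I, Complex.add_im,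
      Complex.mul_im, Complex.mul_re, Complex.ofReal_re, Complex.ofReal_im, Complex.I_re, Complex.I_im,
      Complex.neg_re, Complex.neg_im, Complex.sub_re, Complex.sub_im]
    field_simp
    ring
  rw [mainTermFormEll, T1, T2, B1, T3, B2, T4]
  field_simp
  ring

/-- **`F_ℓ` on `s·k_a + r·k_b` for any `a ≠ b ≥ 1`, real `s, r`.** [cite: Zhang2022LandauSiegel, §2 (2.10), (2.13)] -/
theorem mainTermFormEll_twoComb {a b : ℕ} (ha : a ≠ 0) (hb : b ≠ 0) (hab : a ≠ b) (s r ℓ : ℝ) :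
    mainTermFormEll ℓ (twoComb a b s r) (twoComb' a b s r) =
      s ^ 2 * (8 * π * (((a : ℝ) - ℓ) * ((a : ℝ) - 2 * ℓ) * ((a : ℝ) - 3 * ℓ)) / a)
        + r ^ 2 * (8 * π * (((b : ℝ) - ℓ) * ((b : ℝ) - 2 * ℓ) * ((b : ℝ) - 3 * ℓ)) / b) := by
  rcases lt_or_gt_of_ne hab with h | h
  · have e1 : twoComb a b s r = twoComb b a r s := by
      funext y; simp only [twoComb]; ring
    have e2 : twoComb' a b s r = twoComb' b a r s := by
      funext y; simp only [twoComb']; ring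
    rw [e1, e2, mainTermFormEll_twoComb_of_lt ha h r s ℓ]
    ring
  · exact mainTermFormEll_twoComb_of_lt hb h s r ℓ

/-- **Additivity** («mainTermFormEll_afeDir_add»): `F_ℓ(s k_a + r k_b) = s² F_ℓ(k_a) + r² F_ℓ(k_b)` for
`a ≠ b ≥ 1`, real `s, r`. [cite: Zhang2022LandauSiegel, §2 (2.10), (2.13)] -/
theorem mainTermFormEll_twoComb_eq_add {a b : ℕ} (ha : a ≠ 0) (hb : b ≠ 0) (hab : a ≠ b) (s r ℓ : ℝ) :
    mainTermFormEll ℓ (twoComb a b s r) (twoComb' a b s r) =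
      s ^ 2 * mainTermFormEll ℓ (afeDir a) (afeDir' a) + r ^ 2 * mainTermFormEll ℓ (afeDir b) (afeDir' b) := by
  rw [mainTermFormEll_twoComb ha hb hab, mainTermFormEll_afeDir ha, mainTermFormEll_afeDir hb]

/-! ## The three `K₀` profiles of the B-ell designs -/

/-- `F_ℓ(k₁ + k₂) = π(40 − 144ℓ + 176ℓ² − 72ℓ³)` (`= −8π(ℓ−1)(9ℓ² − 13ℓ + 5)`).
[cite: Zhang2022LandauSiegel, §2 (2.10), (2.13), (2.23)–(2.25)] -/
theorem mainTermFormEll_k12 (ℓ : ℝ) :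
    mainTermFormEll ℓ (twoComb 1 2 1 1) (twoComb' 1 2 1 1) =
      π * (40 - 144 * ℓ + 176 * ℓ ^ 2 - 72 * ℓ ^ 3) := by
  rw [mainTermFormEll_twoComb one_ne_zero two_ne_zero (by norm_num)]
  push_cast
  field_simp
  ring

/-- `F_ℓ(k₂ + k₃) = π(104 − 240ℓ + 176ℓ² − 40ℓ³)`. [cite: Zhang2022LandauSiegel, §2 (2.10), (2.13), (2.23)–(2.25)] -/
theorem mainTermFormEll_k23 (ℓ : ℝ) :
    mainTermFormEll ℓ (twoComb 2 3 1 1) (twoComb' 2 3 1 1) =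
      π * (104 - 240 * ℓ + 176 * ℓ ^ 2 - 40 * ℓ ^ 3) := by
  rw [mainTermFormEll_twoComb two_ne_zero (by norm_num) (by norm_num)]
  push_cast
  field_simp
  ring

/-- `F_ℓ(k₁ − k₃) = π(80 − 192ℓ + 176ℓ² − 64ℓ³)` (`= F_ℓ(k₁) + F_ℓ(k₃)`; at `ℓ = 1 + ε`:
`−32πε − 16πε²·… `, leading term `−32πε`). [cite: Zhang2022LandauSiegel, §2 (2.10), (2.13), (2.23)–(2.25)] -/
theorem mainTermFormEll_k13 (ℓ : ℝ) :
    mainTermFormEll ℓ (twoComb 1 3 1 (-1)) (twoComb' 1 3 1 (-1)) =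
      π * (80 - 192 * ℓ + 176 * ℓ ^ 2 - 64 * ℓ ^ 3) := by
  rw [mainTermFormEll_twoComb one_ne_zero (by norm_num) (by norm_num)]
  push_cast
  field_simp
  ring

/-- At `ℓ = 1` all three `K₀` profiles are null for `F₁ = 𝔅` (consistent with `k₁, k₂, k₃ ∈ ker 𝔅`), and
`F_ℓ(k₁ − k₃) < 0` for every `ℓ > 1` (`80 − 192ℓ + 176ℓ² − 64ℓ³ = −16(ℓ−1)(4ℓ² − 7ℓ + 5)`, the quadratic having
negative discriminant). [cite: Zhang2022LandauSiegel, §2 (2.10), (2.13)] -/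
theorem mainTermFormEll_k13_neg_of_one_lt {ℓ : ℝ} (hℓ : 1 < ℓ) :
    mainTermFormEll ℓ (twoComb 1 3 1 (-1)) (twoComb' 1 3 1 (-1)) < 0 := by
  rw [mainTermFormEll_k13]
  have h1 : 80 - 192 * ℓ + 176 * ℓ ^ 2 - 64 * ℓ ^ 3 = -16 * (ℓ - 1) * (4 * ℓ ^ 2 - 7 * ℓ + 5) := by ring
  have h2 : 0 < 4 * ℓ ^ 2 - 7 * ℓ + 5 := by nlinarith [sq_nonneg (ℓ - 7 / 8)]
  have h3 : 80 - 192 * ℓ + 176 * ℓ ^ 2 - 64 * ℓ ^ 3 < 0 := by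
    rw [h1]; nlinarith [mul_pos (sub_pos.mpr hℓ) h2]
  exact mul_neg_of_pos_of_neg Real.pi_pos h3

end Literature.NumberTheory.LFunctions.Zhang2022

end
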